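import Summits.BirchSwinnertonDyer.BirchSwinnertonDyer.Theorems.KolyvaginRankRigidityAtTwoDeepEngineAdapter
import Summits.BirchSwinnertonDyer.BirchSwinnertonDyer.Theorems.GenusKolyvaginAtTwoEquivariantChebotarevAtTwoVisible
import HarnessLib

/-!
# Crux U1 `KolyvaginBoundedDefectAtTwo` (stmt-BirchSwinnertonDyer-28083), LINE 17 `kolyvagin_swap` —
# ES · DEEP REGULAR ENGINE SUPPLY AT 2 (pen bsd-idea-1 v8.1–v8.5, `line17/SWalphaSplit.lean` def l.217, stub `stub_engineSupplyAtTwo`;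
# `kolyvagin_swap_v82.lean` l.695 / stub l.1131; the last of the three typed M-stubs {ES, SC, SRF} from which SWα⁗ is derived in the
# kernel) — PROVED from the deep engine adapter (file 1 `KolyvaginRankRigidityAtTwoDeepEngineAdapter`), loss constant `C = 4`

Pen `bsd-idea-1` g17 (`--supports stmt-BirchSwinnertonDyer-28083`, helper; file 2 of 2; the conversion to landable form and the diagnosis of
the elaboration defects of the g16 text are the width seat `bsd-line-krr2-p2` g18's, `Cruxes/KolyvaginBoundedDefectAtTwo/ES-HANDOFF-g18.md`).
HONEST FRAMING: ES is a typed sub-target of the pen's split of SWα⁗; with SC (`RegularWalk.shapeCutAtTwo`, p729679) and SRF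
(`RegularWalk.shapeRefillAtTwo`, p728771) it closes SWα⁗ in the pen's kernel `shedSeedPrimeShapedAtTwo_of`; nothing here proves U1
`KolyvaginBoundedDefectAtTwo` (open: S0ʳ = Kolyvagin's conjecture at 2 as INPUT, P372 = Gross 1991 Prop. 3.7(2) in print), a rung, or BSD.
**BSD is NOT proved.**

## Statement
`RegularWalk.engineSupplyAtTwo` = the pen's `EngineSupplyAtTwo` BYTE-FOR-BYTE (it contains no pen definition, so the v8.x stub closes by
`exact engineSupplyAtTwo`): at a walk level `M` and a DEEP level `I ≥ M+1`, for `(−u)`-classes `y₁ … y_k`, `z` and a `u`-class `c` in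
`H¹(K, E[2^M])` with `2^(a+C) z ∉ ℤy + ker res_{Γ_{K(E[2^{M+1}])}}` and `2^(b+C) c` visible on `Γ_{K(E[2^M])}`, there is a REGULAR Kolyvagin prime
`ℓ > bnd` of index `≥ I` with a place `v ∣ ℓ` at which every `yᵢ` is locally trivial and `2^a z`, `2^b c` are not.

## Proof (`C = 4`)
The span `S = ⟨y, z, c⟩` is finite and `τ`-stable; DA (`RegularValueEngine.deepEngineAdapterAtTwo`) gives `ℓ`; kept classes are local
zeros (`mem_torsionLocalKer_iff_res_eq_zero`); if `2^a z` died locally, DA's cut law gives `(2^a z − Σ b'y)|Γ_I = 0`, DL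
(`h1Eval_smul_eq_zero_of_deep`, `λ = 9`) gives `8·(…)|Γ_M = 0`, hence `(2^{a+4} z − Σ 16b'y)|Γ_{M+1} = 0` — excluded; if `2^b c` died
locally, `(2^b c − Σ b'y)|Γ_I = 0`, the sign trick (`y` of sign `−u`, `c` of sign `u`, deep sign transfer
`forall_h1Eval_conjAct_eq_of_dvd`) gives `2^{b+1} c|Γ_I = 0`, DL gives `2^{b+4}[c, ρ] = 0` on `Γ_M` — excluded.
References (locators only; no cited FACT is declared): [cite: GrossLMS1991, §9 (pairing after Prop. 9.1)]
[cite: MazurRubin2004, §4.1, Prop. 4.1.5] [cite: McCallumLMS1991, §3 Prop. 3.1].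
Design: no definitions; `K : Type`; the `zsmul` identities and the sign trick are proved over a generic `AddCommGroup`
(`section Plumbing`) and instantiated, because the `ℤ`-action on `galH1Torsion` is not syntactically the `Module` path;
axioms `propext`, `Classical.choice`, `Quot.sound` (checked).
-/

set_option autoImplicit false
-- the Theorems namespace of this sub repeats the summit name by design (D-0017 nested layout)
set_option linter.dupNamespace false

noncomputable section

open scoped Classical
open Function WeierstrassCurve Field Finset NumberField IsDedekindDomain
open Literature.NumberTheory Literature.NumberTheory.EllipticCurves Literature.NumberTheory.EllipticCurves.KolyvaginPairing
open Literature.NumberTheory.GaloisRepresentations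
open Summit.BirchSwinnertonDyer.BirchSwinnertonDyer.Theorems

namespace Summit.BirchSwinnertonDyer.BirchSwinnertonDyer.Theorems.KolyvaginAtTwo.RegularWalk

/-! ### ES from DA (loss constant `C = 4`) -/

section Plumbing

variable {V : Type*} [AddCommGroup V]

/-- `2^(a+4) • z − Σ (16 bᵢ) • yᵢ = 2 • (8 • (2^a • z − Σ bᵢ • yᵢ))`, generic spelling (safe to instantiate on `H¹(K, E[2^M])`, whose
`ℤ`-action is not syntactically the `Module` path). [folklore] -/
theorem two_pow_add_four_zsmul_sub_sum_eq {k : ℕ} (a : ℕ) (z : V) (y : Fin k → V) (b' : Fin k → ℤ) :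
    ((2 ^ (a + 4) : ℕ) : ℤ) • z - ∑ i, (16 * b' i) • y i =
      (2 : ℤ) • ((9 - 1 : ℤ) • (((2 ^ a : ℕ) : ℤ) • z - ∑ i, b' i • y i)) := by
  rw [smul_smul, smul_sub, Finset.smul_sum]
  congr 1
  · rw [smul_smul]; congr 1; push_cast; ring
  · refine Finset.sum_congr rfl fun i _ ↦ ?_
    rw [smul_smul, show (2 : ℤ) * (9 - 1) = 16 from rfl]

/-- `(2^b • c − s) + (2^b • c + s) = 2^(b+1) • c`, generic spelling. [folklore] -/
theorem two_pow_zsmul_sub_add_add_eq (b : ℕ) (c s : V) :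
    (((2 ^ b : ℕ) : ℤ) • c - s) + (((2 ^ b : ℕ) : ℤ) • c + s) = ((2 ^ (b + 1) : ℕ) : ℤ) • c := by
  rw [sub_add_add_cancel, ← add_zsmul]; congr 1; push_cast; ring

/-- `n • u • c − Σ bᵢ • (−u) • yᵢ = u • (n • c + Σ bᵢ • yᵢ)`, generic spelling. [folklore] -/
theorem zsmul_smul_sub_sum_eq {k : ℕ} (u n : ℤ) (c : V) (y : Fin k → V) (b' : Fin k → ℤ) :
    n • u • c - ∑ x, b' x • (-u) • y x = u • (n • c + ∑ i, b' i • y i) := by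
  rw [smul_add, Finset.smul_sum, sub_eq_add_neg, ← Finset.sum_neg_distrib]
  congr 1
  · rw [smul_comm]
  · exact Finset.sum_congr rfl fun i _ ↦ by rw [smul_comm (b' i) (-u) (y i), neg_smul, neg_neg]

/-- THE SIGN TRICK, generic spelling: an additive map acting as `u` on `c` and as `−u` on every `yᵢ` sends `n • c − Σ bᵢ • yᵢ` to
`u • (n • c + Σ bᵢ • yᵢ)`. [folklore] -/
theorem map_sub_sum_eq_smul_of_sign {k : ℕ} {F : Type*} [FunLike F V V] [AddMonoidHomClass F V V] (f : F) (u n : ℤ)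
    (c : V) (y : Fin k → V) (b' : Fin k → ℤ) (hc : f c = u • c) (hy : ∀ i, f (y i) = (-u) • y i) :
    f (n • c - ∑ i, b' i • y i) = u • (n • c + ∑ i, b' i • y i) := by
  rw [map_sub, map_zsmul, hc, map_sum, ← zsmul_smul_sub_sum_eq u n c y b']
  congr 1
  exact Finset.sum_congr rfl fun i _ ↦ by rw [map_zsmul, hy]

/-- A class killed by a unit `u = ±1` is zero, generic spelling. [folklore] -/
theorem eq_zero_of_unit_zsmul_eq_zero (u : ℤ) (hu : u = 1 ∨ u = -1) (E : V) (h : u • E = 0) : E = 0 := by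
  rcases hu with rfl | rfl
  · rwa [one_zsmul] at h
  · rwa [neg_one_zsmul, neg_eq_zero] at h

end Plumbing

/-- **ES · DEEP REGULAR ENGINE SUPPLY AT 2** — the pen's v8.x stub `EngineSupplyAtTwo`, byte-for-byte, as a theorem (`C = 4`).
See the module docstring. [cite: GrossLMS1991, §9] [cite: MazurRubin2004, §4.1, Prop. 4.1.5] -/
theorem engineSupplyAtTwo :
  ∀ (W : WeierstrassCurve ℚ) [W.IsElliptic] [W.IsGloballyMinimal], ¬ W.HasCM → (Literature.NumberTheory.EllipticCurves.Rank1Residual.GoodOrd W 2 ∨ Literature.NumberTheory.EllipticCurves.Rank1Residual.Mult W 2) → (∀ m : ℕ, W.HasSurjectiveModNGaloisRep (2 ^ m : ℕ)) → ∀ (K : Type) [Field K] [NumberField K], Literature.NumberTheory.EllipticCurves.IsImaginaryQuadratic K → ∀ [NeZero (W.conductorNorm ℤ)], Literature.NumberTheory.EllipticCurves.SatisfiesHeegnerHypothesis (W.conductorNorm ℤ) K → Odd (NumberField.discr K) → NumberField.discr K ≠ -3 → AddSubgroup.torsionBy (W.baseChange K).toAffine.Point (2 : ℤ) = ⊥ →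 Literature.NumberTheory.EllipticCurves.SatisfiesHeegnerHypothesis 2 K → ∀ (Dt : Literature.NumberTheory.EllipticCurves.ModularForms.ModularParametrizationData W (W.conductorNorm ℤ)) (β : ℤ) (ι : K →+* ℂ) [∀ k : ℕ, NumberField (ringClassField K ι k)], (4 * (W.conductorNorm ℤ : ℤ)) ∣ β ^ 2 - NumberField.discr K →
    ∀ (τ : K ≃ₐ[ℚ] K), τ ≠ 1 → ∀ (u : ℤ), (u = 1 ∨ u = -1) →
    ∃ C : ℕ, ∀ (M I bnd k a b : ℕ) (y : Fin k → galH1Torsion (W.baseChange K) ((2 ^ M : ℕ) : ℤ))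
      (z c : galH1Torsion (W.baseChange K) ((2 ^ M : ℕ) : ℤ)),
      1 ≤ M → M + 1 ≤ I →
      (∀ i, conjAct W τ ((2 ^ M : ℕ) : ℤ) (y i) = (-u) • y i) →
      conjAct W τ ((2 ^ M : ℕ) : ℤ) z = (-u) • z →
      conjAct W τ ((2 ^ M : ℕ) : ℤ) c = u • c →
      (∀ bv : Fin k → ℤ, ¬ ∀ σ ∈ torsionFixing (W.baseChange K) ((2 ^ (M + 1) : ℕ) : ℤ),
          h1Eval (W.baseChange K) ((2 ^ M : ℕ) : ℤ) (((2 ^ (a + C) : ℕ) : ℤ) • z - ∑ i, bv i • y i) σ = 0) →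
      (∃ ρ ∈ torsionFixing (W.baseChange K) ((2 ^ M : ℕ) : ℤ),
          ((2 ^ (b + C) : ℕ) : ℤ) • h1Eval (W.baseChange K) ((2 ^ M : ℕ) : ℤ) c ρ ≠ 0) →
      ∃ ℓ : ℕ, bnd < ℓ ∧ Literature.NumberTheory.EllipticCurves.Zhang2014.IsKolyvaginPrime (W.conductorNorm ℤ) W K 2 ℓ ∧
        (I ≤ Literature.NumberTheory.EllipticCurves.Zhang2014.kolyvaginIndex W 2 ℓ ∧ (∃ (pl : HeightOneSpectrum (𝓞 ℚ)) (𝔓 : Ideal (absIntegers (𝓞 ℚ) ℚ)) (h : absoluteGaloisGroup ℚ), (ℓ : 𝓞 ℚ) ∈ pl.asIdeal ∧ 𝔓 ∈ pl.primesAbove ∧ IsArithFrobAt (𝓞 ℚ) h 𝔓 ∧ (∀ X : geomTorsion W ((2 ^ M : ℕ) : ℤ), h • h • X = X) ∧ ∃ P : geomTorsion W ((2 ^ M : ℕ) : ℤ), (2 : ℤ) ^ (M - 1) • (P + h • P) ≠ 0)) ∧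
        ∃ v : IsDedekindDomain.HeightOneSpectrum (NumberField.RingOfIntegers K), (ℓ : NumberField.RingOfIntegers K) ∈ v.asIdeal ∧
          (∀ i, y i ∈ (W.baseChange K).torsionLocalKer (v.adicCompletion K) ((2 ^ M : ℕ) : ℤ)) ∧
          ((2 ^ a : ℕ) : ℤ) • z ∉ (W.baseChange K).torsionLocalKer (v.adicCompletion K) ((2 ^ M : ℕ) : ℤ) ∧
          ((2 ^ b : ℕ) : ℤ) • c ∉ (W.baseChange K).torsionLocalKer (v.adicCompletion K) ((2 ^ M : ℕ) : ℤ) := by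
  intro W _ _ _hCM _hred hsurj K _ _ hK _ hH hodd _hd3 _htors _hH2 _Dt _β _ι _ _hβ τ hτ u hu
  refine ⟨4, ?_⟩
  intro M I bnd k a b y z c hM hMI hyτ hzτ hcτ hzspan hcvis
  classical
  haveI : NeZero (2 ^ M) := ⟨pow_ne_zero M two_ne_zero⟩
  haveI hEK : (W.baseChange K).IsElliptic := by unfold WeierstrassCurve.baseChange; infer_instance
  -- levels
  have hdvdMI : ((2 ^ M : ℕ) : ℤ) ∣ ((2 ^ I : ℕ) : ℤ) := by exact_mod_cast pow_dvd_pow 2 (by omega : M ≤ I)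
  have hleIM : torsionFixing (W.baseChange K) ((2 ^ I : ℕ) : ℤ) ≤ torsionFixing (W.baseChange K) ((2 ^ M : ℕ) : ℤ) :=
    KolyvaginLowerBoundAtTwo.torsionFixing_le_of_dvd _ hdvdMI
  have hleM1M : torsionFixing (W.baseChange K) ((2 ^ (M + 1) : ℕ) : ℤ) ≤
      torsionFixing (W.baseChange K) ((2 ^ M : ℕ) : ℤ) :=
    KolyvaginLowerBoundAtTwo.torsionFixing_le_of_dvd _ (by exact_mod_cast pow_dvd_pow 2 (Nat.le_succ M))
  -- the homothety `9` on `E[2^I]`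
  obtain ⟨σ, hσ⟩ := RegularValueEngine.exists_smul_eq_nine W K hK.1 I (hsurj I)
  -- the span of the classes: finite and `τ`-stable
  let gens : Fin (k + 1 + 1) → galH1Torsion (W.baseChange K) ((2 ^ M : ℕ) : ℤ) := Fin.cons z (Fin.cons c y)
  set S : AddSubgroup (galH1Torsion (W.baseChange K) ((2 ^ M : ℕ) : ℤ)) := AddSubgroup.closure (Set.range gens)
    with hS
  haveI : Finite S :=
    (GenusExact.finite_closure_range_of_zsmul_eq_zero gens (q := 2 ^ M) (pow_ne_zero M two_ne_zero)
      (zsmul_galH1Torsion_eq_zero _ _)).to_subtype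
  have hzS : z ∈ S := AddSubgroup.subset_closure ⟨0, by simp [gens]⟩
  have hcS : c ∈ S := AddSubgroup.subset_closure ⟨(0 : Fin (k + 1)).succ, by simp [gens]⟩
  have hyS : ∀ i, y i ∈ S := fun i ↦ AddSubgroup.subset_closure ⟨i.succ.succ, by simp [gens]⟩
  have hgen : ∀ i, conjAct W τ ((2 ^ M : ℕ) : ℤ) (gens i) ∈ S := by
    intro i
    refine Fin.cases ?_ (fun j ↦ ?_) i
    · simp only [gens, Fin.cons_zero, hzτ]; exact S.zsmul_mem hzS _
    · refine Fin.cases ?_ (fun j' ↦ ?_) j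
      · simp only [gens, Fin.cons_succ, Fin.cons_zero, hcτ]; exact S.zsmul_mem hcS _
      · simp only [gens, Fin.cons_succ, hyτ]; exact S.zsmul_mem (hyS j') _
  have hSτ : ∀ x ∈ S, conjAct W τ ((2 ^ M : ℕ) : ℤ) x ∈ S := by
    intro x hx
    refine AddSubgroup.closure_induction (p := fun x _ ↦ conjAct W τ ((2 ^ M : ℕ) : ℤ) x ∈ S) ?_ ?_ ?_ ?_ hx
    · rintro _ ⟨i, rfl⟩; exact hgen i
    · rw [map_zero]; exact S.zero_mem
    · intro x₁ x₂ _ _ h₁ h₂; rw [map_add]; exact S.add_mem h₁ h₂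
    · intro x₁ _ h₁; rw [map_neg]; exact S.neg_mem h₁
  -- the deep adapter
  obtain ⟨ℓ, hbnd, hKol, hidx, hreg, hloc⟩ :=
    RegularValueEngine.deepEngineAdapterAtTwo W K hK hodd hH hM hMI hsurj hτ S hSτ y hyS (fun _ ↦ -u) hyτ hzS hcS hzτ
      hcτ bnd
  obtain ⟨v, hv⟩ := KolyvaginAtTwo.RegularWalk.exists_place_natCast_mem_of_kolyvaginPrime W hKol
  haveI : CharZero (v.adicCompletion K) := charZero_of_injective_algebraMap (algebraMap K _).injective
  obtain ⟨hy0, hzcut, hccut⟩ := hloc v hv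
  refine ⟨ℓ, hbnd, hKol, ⟨hidx, hreg⟩, v, hv, ?_, ?_, ?_⟩
  · -- kept classes die locally
    intro i
    exact (mem_torsionLocalKer_iff_res_eq_zero (W.baseChange K) (v.adicCompletion K) (k := 2 ^ M)
      (pow_ne_zero M two_ne_zero) (y i)).mpr (hy0 i)
  · -- `2^a z` survives locally
    intro hmem
    have hres := (mem_torsionLocalKer_iff_res_eq_zero (W.baseChange K) (v.adicCompletion K) (k := 2 ^ M)
      (pow_ne_zero M two_ne_zero) _).mp hmem
    have hloc0 : ((2 ^ a : ℕ) : ℤ) • galoisCohomology.localization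
        ((W.baseChange K).torsionGaloisModule ((2 ^ M : ℕ) : ℤ)) (Sum.inr v : Place K) 1 z = 0 := by
      rw [← map_zsmul]; exact hres
    obtain ⟨b', hb'⟩ := (hzcut _).mp hloc0
    have hDL := RegularValueEngine.h1Eval_smul_eq_zero_of_deep (W.baseChange K) hdvdMI hσ _ hb'
    refine hzspan (fun i ↦ 16 * b' i) fun ρ hρ ↦ ?_
    have hρM : ρ ∈ torsionFixing (W.baseChange K) ((2 ^ M : ℕ) : ℤ) := hleM1M hρ
    have h1 := hDL ρ hρM
    have hid : ((2 ^ (a + 4) : ℕ) : ℤ) • z - ∑ i, (16 * b' i) • y i =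
        (2 : ℤ) • ((9 - 1 : ℤ) • (((2 ^ a : ℕ) : ℤ) • z - ∑ i, b' i • y i)) :=
      two_pow_add_four_zsmul_sub_sum_eq a z y b'
    show h1Eval (W.baseChange K) ((2 ^ M : ℕ) : ℤ) (((2 ^ (a + 4) : ℕ) : ℤ) • z - ∑ i, (16 * b' i) • y i) ρ = 0
    rw [hid, h1Eval_zsmul _ _ _ _ hρM, h1, smul_zero]
  · -- `2^b c` survives locally
    intro hmem
    have hres := (mem_torsionLocalKer_iff_res_eq_zero (W.baseChange K) (v.adicCompletion K) (k := 2 ^ M)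
      (pow_ne_zero M two_ne_zero) _).mp hmem
    have hloc0 : ((2 ^ b : ℕ) : ℤ) • galoisCohomology.localization
        ((W.baseChange K).torsionGaloisModule ((2 ^ M : ℕ) : ℤ)) (Sum.inr v : Place K) 1 c = 0 := by
      rw [← map_zsmul]; exact hres
    obtain ⟨b', hb'⟩ := (hccut _).mp hloc0
    -- sign trick at the deep level
    have hτX := RegularValueEngine.forall_h1Eval_conjAct_eq_of_dvd W hK hτ hdvdMI
      (x := ((2 ^ b : ℕ) : ℤ) • c - ∑ i, b' i • y i) (x' := 0)
      (fun ρ hρ ↦ by rw [hb' ρ hρ, h1Eval_zero _ _ (hleIM hρ)])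
    have hconj : conjAct W τ ((2 ^ M : ℕ) : ℤ) (((2 ^ b : ℕ) : ℤ) • c - ∑ i, b' i • y i) =
        u • (((2 ^ b : ℕ) : ℤ) • c + ∑ i, b' i • y i) :=
      map_sub_sum_eq_smul_of_sign (conjAct W τ ((2 ^ M : ℕ) : ℤ)) u _ c y b' hcτ hyτ
    have hY : ∀ ρ ∈ torsionFixing (W.baseChange K) ((2 ^ I : ℕ) : ℤ),
        h1Eval (W.baseChange K) ((2 ^ M : ℕ) : ℤ) (((2 ^ (b + 1) : ℕ) : ℤ) • c) ρ = 0 := by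
      intro ρ hρ
      have hρM : ρ ∈ torsionFixing (W.baseChange K) ((2 ^ M : ℕ) : ℤ) := hleIM hρ
      have h1 := hb' ρ hρ
      have h2 := hτX ρ hρ
      rw [map_zero, h1Eval_zero _ _ hρM, hconj, h1Eval_zsmul _ _ _ _ hρM] at h2
      have h3 : h1Eval (W.baseChange K) ((2 ^ M : ℕ) : ℤ) (((2 ^ b : ℕ) : ℤ) • c + ∑ i, b' i • y i) ρ = 0 :=
        eq_zero_of_unit_zsmul_eq_zero u hu _ h2
      have h4 : (((2 ^ b : ℕ) : ℤ) • c - ∑ i, b' i • y i) + (((2 ^ b : ℕ) : ℤ) • c + ∑ i, b' i • y i) =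
          ((2 ^ (b + 1) : ℕ) : ℤ) • c :=
        two_pow_zsmul_sub_add_add_eq b c (∑ i, b' i • y i)
      rw [← h4, h1Eval_add _ _ _ _ hρM, h1, h3, add_zero]
    obtain ⟨ρ₀, hρ₀, hne⟩ := hcvis
    apply hne
    have hDL := RegularValueEngine.h1Eval_smul_eq_zero_of_deep (W.baseChange K) hdvdMI hσ _ hY ρ₀ hρ₀
    rw [h1Eval_zsmul _ _ _ _ hρ₀, h1Eval_zsmul _ _ _ _ hρ₀, smul_smul] at hDL
    have h5 : ((2 ^ (b + 4) : ℕ) : ℤ) = (9 - 1) * ((2 ^ (b + 1) : ℕ) : ℤ) := by push_cast; ring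
    rw [h5]; exact hDL

end Summit.BirchSwinnertonDyer.BirchSwinnertonDyer.Theorems.KolyvaginAtTwo.RegularWalk

end
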